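import Summits.BirchSwinnertonDyer.BirchSwinnertonDyer.Theorems.SignedBaseChangeAnticyclotomicEisensteinDivisibilitySpecializationHerbrand
import HarnessLib

/-!
# Specialisation of characteristic ideals along a retraction `φ : B → A` with kernel `(π)`:
# cyclic modules and the principal generator (proofs)

Helper file for crux 4 `BSDpOnCellC` (stmt-BirchSwinnertonDyer-19034, line «telescope» v4, registered stub
`stub_herbrandTranslate`; width seat `bsd-line-x2-p2`, `--supports`). It GENERALISES, token by token, the tree's
`Theorems/SignedBaseChangeAnticyclotomicEisensteinDivisibilitySpecializationCyclic.lean` (namespace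
`…SignedBaseChangeAcDivSpecialization.PowerSeriesSpecialization`: the case `B = A⟦X⟧`, `π = X`, `φ = constantCoeff`) to the
setting of the stub: an `A`-algebra `B` with a ring RETRACTION `φ : B →+* A` (`φ ∘ algebraMap = id`) whose kernel is
the principal ideal `(π)` (`φ π = 0`, `φ b = 0 → π ∣ b`), and a `B`-module `N` with a compatible `A`-structure
(`[Module A N] [IsScalarTower A B N]`); `N/πN = QuotSMulTop π N`, `N[π] = Submodule.torsionBy B N π`.

* the retraction: `ker φ = (π)`, `(I.map φ).comap φ = I + (π)`; `ker φ` kills `N/πN` and `N[π]`, so these are finitely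
  generated `A`-modules killed by `φ s` whenever `s` kills `N` (`moduleFinite_quotSMulTop_of_retraction`,
  `moduleFinite_torsionBy_of_retraction`, `isTorsionBy_map_of_retraction'`);
* the cyclic modules `B/𝔭`: `(B/𝔭)[π] = 0` or everything, `(B/I)/π ≃ₗ[A] A/φ(I)`, the height bound `ht φ⁻¹𝔮 ≤ 2` for a
  height-one `𝔮 ⊂ A` (Krull), and the **cyclic case of the local Herbrand formula** `lengthAt_cyclic_of_retraction`:
  `ℓ_𝔮((B/𝔭)/π) = ℓ_𝔮((B/𝔭)[π]) + ℓ_𝔮(A/φ(char(B/𝔭)))` for `𝔭 ≠ 0, (π)` (`π ≠ 0`, `A`, `B` Noetherian domains);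
* for `B` factorial: the characteristic ideal of a module killed by some `s` with `φ s ≠ 0` is principal with generator
  `F`, `φ F ≠ 0` (`exists_charIdeal_eq_span_of_retraction`), and `ℓ_𝔮(A/φ(char ·))` is additive in short exact sequences
  (`lengthAt_quotient_map_charIdeal_eq_add_of_retraction`).

Theorems only, [folklore] commutative algebra (Bourbaki AC VII §4.4–4.5); nothing about elliptic curves is asserted; no
summit statement, crux or stub is proved in THIS file. Sequel: `…RetractionSpecializationHerbrand.lean` (dévissage, the
two-sided Herbrand formula, and the stub).

## References

* N. Bourbaki, *Algèbre commutative*, Ch. VII §4.4–4.5. [BourbakiAC5to7]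
* T. Ochiai, *On the two-variable Iwasawa main conjecture*, Compos. Math. 142 (2006), Lemma 7.2. [Ochiai2006]
* D. Delbourgo, *Elliptic Curves and Big Galois Representations*, LMS LNS 356 (2008), Ch. X Lemma 10.5. [Delbourgo2008]
-/

noncomputable section

open Function
open scoped Pointwise

-- D-0017: single-problem summit, the namespace repeats the problem name by design.
set_option linter.dupNamespace false
set_option autoImplicit false

namespace Summit.BirchSwinnertonDyer.BirchSwinnertonDyer.Theorems.RetractionSpecialization

open Literature.NumberTheory.EllipticCurves Literature.NumberTheory.EllipticCurves.Module
open Summit.BirchSwinnertonDyer.BirchSwinnertonDyer.Theorems.SignedBaseChangeAcDivSpecialization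
open Summit.BirchSwinnertonDyer.BirchSwinnertonDyer.Theorems.SignedBaseChangeAcDivSpecialization.LocalLength

universe u w v

variable {A : Type u} {B : Type w} [CommRing A] [CommRing B] {π : B} {φ : B →+* A}

/-! ### The kernel `(π)` of `φ : B → A` (no `A`-algebra structure needed) -/

section Kernel

/-- `r ∈ (π)` iff `φ r = 0` (the kernel of `φ` is `(π)`). [folklore] -/
theorem mem_span_iff_map_eq_zero (hφπ : φ π = 0) (hker : ∀ b : B, φ b = 0 → π ∣ b) {r : B} :
    r ∈ Ideal.span {π} ↔ φ r = 0 := by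
  rw [Ideal.mem_span_singleton]
  refine ⟨fun ⟨c, hc⟩ => ?_, hker r⟩
  rw [hc, map_mul, hφπ, zero_mul]

/-- `ker φ = (π)`. [folklore] -/
theorem ker_eq_span (hφπ : φ π = 0) (hker : ∀ b : B, φ b = 0 → π ∣ b) :
    RingHom.ker φ = Ideal.span {π} := by
  ext r
  rw [RingHom.mem_ker, mem_span_iff_map_eq_zero hφπ hker]

/-- `(π)` is prime when `A` is a domain (`B/(π) ≅ A`). [folklore] -/
theorem isPrime_span [IsDomain A] (hφπ : φ π = 0) (hker : ∀ b : B, φ b = 0 → π ∣ b) :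
    (Ideal.span {π}).IsPrime := by
  rw [← ker_eq_span hφπ hker]
  exact RingHom.ker_isPrime φ

/-- `π ≠ 0` is a prime element when `A` is a domain. [folklore] -/
theorem prime_of_ne_zero [IsDomain A] (hφπ : φ π = 0) (hker : ∀ b : B, φ b = 0 → π ∣ b)
    (hπ0 : π ≠ 0) : Prime π :=
  (Ideal.span_singleton_prime hπ0).mp (isPrime_span hφπ hker)

/-- `(π) ⊂ B` has height one for `π ≠ 0` (`A`, `B` domains). [folklore] -/
theorem height_span_eq_one [IsDomain A] [IsDomain B] [IsNoetherianRing B] (hφπ : φ π = 0)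
    (hker : ∀ b : B, φ b = 0 → π ∣ b) (hπ0 : π ≠ 0) : (Ideal.span {π}).height = 1 :=
  height_span_singleton_eq_one_of_prime (prime_of_ne_zero hφπ hker hπ0)

variable {N : Type v} [AddCommGroup N] [Module B N]

/-- `ker φ` kills `N/πN`. [folklore] -/
theorem smul_quotSMulTop_eq_zero' (hker : ∀ b : B, φ b = 0 → π ∣ b) (r : B) (m : QuotSMulTop π N)
    (hr : φ r = 0) : r • m = 0 := by
  obtain ⟨r', rfl⟩ := hker r hr
  obtain ⟨n, rfl⟩ := Submodule.Quotient.mk_surjective _ m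
  have h : (π * r') • (Submodule.Quotient.mk n : QuotSMulTop π N) =
      Submodule.Quotient.mk (π • (r' • n)) := by
    rw [← mul_smul, Submodule.Quotient.mk_smul]
  rw [h, Submodule.Quotient.mk_eq_zero]
  exact Submodule.smul_mem_pointwise_smul _ _ _ Submodule.mem_top

/-- `ker φ` kills `N[π]`. [folklore] -/
theorem smul_torsionBy_eq_zero' (hker : ∀ b : B, φ b = 0 → π ∣ b) (r : B)
    (m : Submodule.torsionBy B N π) (hr : φ r = 0) : r • m = 0 := by
  obtain ⟨r', rfl⟩ := hker r hr
  apply Subtype.ext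
  rw [Submodule.coe_smul, Submodule.coe_zero, mul_comm, mul_smul]
  have := (Submodule.mem_torsionBy_iff π (m : N)).mp m.2
  rw [this, smul_zero]

/-- If `π ∉ I` with `I` prime then `(B/I)[π] = 0`. [folklore] -/
theorem torsionBy_quotient_eq_bot' {I : Ideal B} [I.IsPrime] (hπI : π ∉ I) :
    Submodule.torsionBy B (B ⧸ I) π = ⊥ := by
  rw [eq_bot_iff]
  intro y hy
  obtain ⟨a, rfl⟩ := Ideal.Quotient.mk_surjective y
  rw [Submodule.mem_torsionBy_iff] at hy
  change Ideal.Quotient.mk I (π * a) = 0 at hy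
  rw [Ideal.Quotient.eq_zero_iff_mem] at hy
  rw [Submodule.mem_bot, Ideal.Quotient.eq_zero_iff_mem]
  exact ((‹I.IsPrime›).mem_or_mem hy).resolve_left hπI

/-- If `π ∈ I` then `(B/I)[π]` is everything. [folklore] -/
theorem torsionBy_quotient_eq_top' {I : Ideal B} (hπI : π ∈ I) :
    Submodule.torsionBy B (B ⧸ I) π = ⊤ := by
  rw [eq_top_iff]
  intro y _
  obtain ⟨a, rfl⟩ := Ideal.Quotient.mk_surjective y
  rw [Submodule.mem_torsionBy_iff]
  change Ideal.Quotient.mk I (π * a) = 0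
  rw [Ideal.Quotient.eq_zero_iff_mem]
  exact I.mul_mem_right _ hπI

/-- If `π ∈ I` then `π · (B/I) = 0`. [folklore] -/
theorem smul_top_quotient_eq_bot' {I : Ideal B} (hπI : π ∈ I) :
    (π • ⊤ : Submodule B (B ⧸ I)) = ⊥ := by
  rw [eq_bot_iff]
  intro y hy
  obtain ⟨z, -, rfl⟩ := (Submodule.mem_smul_pointwise_iff_exists _ _ _).mp hy
  obtain ⟨a, rfl⟩ := Ideal.Quotient.mk_surjective z
  rw [Submodule.mem_bot]
  change Ideal.Quotient.mk I (π * a) = 0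
  rw [Ideal.Quotient.eq_zero_iff_mem]
  exact I.mul_mem_right _ hπI

/-- `π · (B/I) = ((π) + I)/I`. [folklore] -/
theorem smul_top_quotient_eq_map' (I : Ideal B) :
    (π • ⊤ : Submodule B (B ⧸ I)) = Submodule.map (Submodule.mkQ I) (Ideal.span {π}) := by
  ext y
  rw [Submodule.mem_smul_pointwise_iff_exists, Submodule.mem_map]
  constructor
  · rintro ⟨z, -, rfl⟩
    obtain ⟨a, rfl⟩ := Submodule.Quotient.mk_surjective I z
    exact ⟨π * a, Ideal.mem_span_singleton'.mpr ⟨a, mul_comm _ _⟩, rfl⟩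
  · rintro ⟨h, hh, rfl⟩
    obtain ⟨a, rfl⟩ := Ideal.mem_span_singleton'.mp hh
    exact ⟨Submodule.Quotient.mk a, Submodule.mem_top, by
      rw [Submodule.mkQ_apply, mul_comm, ← smul_eq_mul, Submodule.Quotient.mk_smul]⟩

end Kernel

/-! ### The retraction `φ : B → A` of an `A`-algebra (`φ ∘ algebraMap = id`) -/

variable [Algebra A B]

/-- A retraction of the structure map is surjective. [folklore] -/
theorem surjective_of_retraction (hφ : ∀ a : A, φ (algebraMap A B a) = a) : Surjective φ :=
  fun a => ⟨algebraMap A B a, hφ a⟩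

/-- The image of an ideal under `φ` pulls back to `I + (π)`. [folklore] -/
theorem comap_map_eq_sup (hφ : ∀ a : A, φ (algebraMap A B a) = a) (hφπ : φ π = 0)
    (hker : ∀ b : B, φ b = 0 → π ∣ b) (I : Ideal B) :
    (I.map φ).comap φ = I ⊔ Ideal.span {π} := by
  rw [Ideal.comap_map_of_surjective _ (surjective_of_retraction hφ), ← RingHom.ker_eq_comap_bot,
    ker_eq_span hφπ hker]

variable {N : Type v} [AddCommGroup N] [Module B N]

section WithA

variable [Module A N] [IsScalarTower A B N]

/-- `N/πN` is finitely generated over `A` when `N` is finitely generated over `B`. [folklore] -/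
theorem moduleFinite_quotSMulTop_of_retraction (hφ : ∀ a : A, φ (algebraMap A B a) = a)
    (hker : ∀ b : B, φ b = 0 → π ∣ b) [Module.Finite B N] :
    Module.Finite A (QuotSMulTop π N) :=
  moduleFinite_of_retraction φ hφ (smul_quotSMulTop_eq_zero' (N := N) hker)

/-- `N[π]` is finitely generated over `A` when `N` is finitely generated over a Noetherian `B`. [folklore] -/
theorem moduleFinite_torsionBy_of_retraction (hφ : ∀ a : A, φ (algebraMap A B a) = a)
    (hker : ∀ b : B, φ b = 0 → π ∣ b) [IsNoetherianRing B] [Module.Finite B N] :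
    Module.Finite A (Submodule.torsionBy B N π) := by
  haveI : IsNoetherian B N := isNoetherian_of_isNoetherianRing_of_finite _ _
  exact moduleFinite_of_retraction φ hφ (smul_torsionBy_eq_zero' (N := N) hker)

/-- If `s ∈ B` kills `N` then `φ s` kills `N/πN` and `N[π]`. [folklore] -/
theorem isTorsionBy_map_of_retraction' (hφ : ∀ a : A, φ (algebraMap A B a) = a)
    (hker : ∀ b : B, φ b = 0 → π ∣ b) {s : B} (hs : ∀ m : N, s • m = 0) :
    Module.IsTorsionBy A (QuotSMulTop π N) (φ s) ∧
      Module.IsTorsionBy A (Submodule.torsionBy B N π) (φ s) := by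
  constructor
  · refine isTorsionBy_map_of_retraction _ hφ (smul_quotSMulTop_eq_zero' (N := N) hker) fun m => ?_
    obtain ⟨n, rfl⟩ := Submodule.Quotient.mk_surjective _ m
    rw [← Submodule.Quotient.mk_smul, hs, Submodule.Quotient.mk_zero]
  · refine isTorsionBy_map_of_retraction _ hφ (smul_torsionBy_eq_zero' (N := N) hker) fun m =>
      Subtype.ext ?_
    rw [Submodule.coe_smul, hs, Submodule.coe_zero]

end WithA

/-! ### Cyclic modules `B/𝔭` -/

section Cyclic

/-- `B/(I + (π)) ≃ A/φ(I)` as `A`-modules: the `A`-algebra map `B → A → A/φ(I)` is onto with kernel `I + (π)`.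
[folklore] -/
theorem nonempty_quotient_sup_span_linearEquiv (hφ : ∀ a : A, φ (algebraMap A B a) = a) (hφπ : φ π = 0)
    (hker : ∀ b : B, φ b = 0 → π ∣ b) (I : Ideal B) :
    Nonempty ((B ⧸ (I ⊔ Ideal.span {π})) ≃ₗ[A] (A ⧸ I.map φ)) := by
  let cc : B →ₐ[A] A := { φ with commutes' := hφ }
  let ψ : B →ₐ[A] A ⧸ I.map φ := (Ideal.Quotient.mkₐ A _).comp cc
  have hψ : Function.Surjective ψ :=
    (Ideal.Quotient.mkₐ_surjective A _).comp (surjective_of_retraction hφ)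
  have hkerψ : RingHom.ker ψ = I ⊔ Ideal.span {π} := by
    rw [← comap_map_eq_sup hφ hφπ hker I]
    ext r
    simp only [RingHom.mem_ker, Ideal.mem_comap]
    exact Ideal.Quotient.eq_zero_iff_mem
  exact ⟨(Ideal.quotientEquivAlgOfEq A hkerψ.symm).toLinearEquiv ≪≫ₗ
    (Ideal.quotientKerAlgEquivOfSurjective hψ).toLinearEquiv⟩

/-- `(B/I)/π ≃ A/φ(I)` as `A`-modules (through `B/(I + (π))`). [folklore] -/
theorem nonempty_quotSMulTop_quotient_linearEquiv' (hφ : ∀ a : A, φ (algebraMap A B a) = a)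
    (hφπ : φ π = 0) (hker : ∀ b : B, φ b = 0 → π ∣ b) (I : Ideal B) :
    Nonempty (QuotSMulTop π (B ⧸ I) ≃ₗ[A] (A ⧸ I.map φ)) := by
  obtain ⟨e⟩ := nonempty_quotient_sup_span_linearEquiv hφ hφπ hker I
  exact ⟨((Submodule.quotEquivOfEq _ _ (smul_top_quotient_eq_map' I)) ≪≫ₗ
    Submodule.quotientQuotientEquivQuotientSup I (Ideal.span {π})).restrictScalars A ≪≫ₗ e⟩

variable [IsDomain A] [IsNoetherianRing B]

omit [IsDomain A] in
/-- The pull-back `Q = φ⁻¹𝔮` of a height-one prime `𝔮 ⊂ A` has height `≤ 2` in `B` (`Q ∋ π` and `Q/(π) ≅ 𝔮` under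
`B/(π) ≅ A`; Krull). [folklore] -/
theorem height_comap_le (hφ : ∀ a : A, φ (algebraMap A B a) = a) (hφπ : φ π = 0)
    (hker : ∀ b : B, φ b = 0 → π ∣ b) (𝔮 : PrimeSpectrum A) (h𝔮 : 𝔮.asIdeal.height = 1) :
    (𝔮.asIdeal.comap φ).height ≤ 2 := by
  set Q := 𝔮.asIdeal.comap φ with hQ
  have hπQ : π ∈ Q := by
    rw [hQ, Ideal.mem_comap, hφπ]; exact 𝔮.asIdeal.zero_mem
  refine (Ideal.height_le_height_add_one_of_mem hπQ).trans ?_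
  -- `B/(π) ≃ A` carries `Q/(π)` to `𝔮`
  let e : (B ⧸ Ideal.span {π}) ≃+* A :=
    (Ideal.quotEquivOfEq (ker_eq_span hφπ hker).symm).trans
      (RingHom.quotientKerEquivOfSurjective (surjective_of_retraction hφ))
  have hcomp : (e : _ →+* A).comp (Ideal.Quotient.mk (Ideal.span {π})) = φ := by
    ext r
    simp [e]
  have hmap : (Q.map (Ideal.Quotient.mk (Ideal.span {π}))).map (e : _ →+* A) = 𝔮.asIdeal := by
    rw [Ideal.map_map, hcomp, hQ, Ideal.map_comap_of_surjective _ (surjective_of_retraction hφ)]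
  have hh : (Q.map (Ideal.Quotient.mk (Ideal.span {π}))).height = 1 := by
    rw [← RingEquiv.height_map e, ← h𝔮]
    exact congrArg Ideal.height hmap
  rw [hh]
  exact le_of_eq (by norm_num)

/-- **The cyclic case.** For `π ≠ 0`, a nonzero prime `𝔭 ≠ (π)` of `B` and a height-one prime `𝔮` of `A`:
`ℓ_𝔮((B/𝔭)/π) = ℓ_𝔮((B/𝔭)[π]) + ℓ_𝔮(A / φ(char(B/𝔭)))`. Cases: `π ∈ 𝔭` (then `ht 𝔭 ≥ 2`, `char = 1`, `π` acts by
`0`); `π ∉ 𝔭` of height one (`char = 𝔭`, `(B/𝔭)[π] = 0`, `(B/𝔭)/π ≅ A/φ(𝔭)`); `π ∉ 𝔭` of height `≥ 2` (both sides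
vanish: a height-one `𝔮 ⊇ φ(𝔭)` would give `𝔭 ⊊ φ⁻¹𝔮`, of height `≤ 2`). [folklore] -/
theorem lengthAt_cyclic_of_retraction [IsDomain B] (hφ : ∀ a : A, φ (algebraMap A B a) = a)
    (hφπ : φ π = 0) (hker : ∀ b : B, φ b = 0 → π ∣ b) (hπ0 : π ≠ 0)
    (𝔭 : PrimeSpectrum B) (h0 : 𝔭.asIdeal ≠ ⊥)
    (hπ𝔭 : 𝔭.asIdeal ≠ Ideal.span {π}) (𝔮 : PrimeSpectrum A) (h𝔮 : 𝔮.asIdeal.height = 1) :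
    lengthAt A (QuotSMulTop π (B ⧸ 𝔭.asIdeal)) 𝔮 =
      lengthAt A (Submodule.torsionBy B (B ⧸ 𝔭.asIdeal) π) 𝔮 +
        lengthAt A (A ⧸ (charIdeal B (B ⧸ 𝔭.asIdeal)).map φ) 𝔮 := by
  by_cases hπmem : π ∈ 𝔭.asIdeal
  · -- `π ∈ 𝔭`: `(π) < 𝔭`, so `ht 𝔭 ≥ 2` and `char(B/𝔭) = 1`; `π` acts by zero
    have hlt : Ideal.span {π} < 𝔭.asIdeal :=
      lt_of_le_of_ne ((Ideal.span_singleton_le_iff_mem _).mpr hπmem) (Ne.symm hπ𝔭)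
    haveI : (Ideal.span {π}).IsPrime := isPrime_span hφπ hker
    have hht : 𝔭.asIdeal.height ≠ 1 := by
      have h := Ideal.height_strict_mono_of_isPrime_of_isPrime hlt
      rw [height_span_eq_one hφπ hker hπ0] at h
      exact ne_of_gt h
    rw [charIdeal_quotient_prime_of_height_ne_one 𝔭 h0 hht, Ideal.one_eq_top, Ideal.map_top,
      PowerSeriesSpecialization.lengthAt_quotient_top, add_zero]
    have e₁ : QuotSMulTop π (B ⧸ 𝔭.asIdeal) ≃ₗ[A] (B ⧸ 𝔭.asIdeal) :=
      (Submodule.quotEquivOfEqBot _ (smul_top_quotient_eq_bot' hπmem)).restrictScalars A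
    have e₂ : Submodule.torsionBy B (B ⧸ 𝔭.asIdeal) π ≃ₗ[A] (B ⧸ 𝔭.asIdeal) :=
      ((LinearEquiv.ofEq _ _ (torsionBy_quotient_eq_top' hπmem)).trans
        Submodule.topEquiv).restrictScalars A
    rw [lengthAt_eq_of_linearEquiv e₁, lengthAt_eq_of_linearEquiv e₂]
  · -- `π ∉ 𝔭`: `(B/𝔭)[π] = 0`, `(B/𝔭)/π ≅ A/φ(𝔭)`
    have hK : lengthAt A (Submodule.torsionBy B (B ⧸ 𝔭.asIdeal) π) 𝔮 = 0 := by
      haveI : Subsingleton (Submodule.torsionBy B (B ⧸ 𝔭.asIdeal) π) := by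
        rw [torsionBy_quotient_eq_bot' hπmem]; infer_instance
      exact lengthAt_eq_zero_of_subsingleton 𝔮
    rw [hK, zero_add]
    obtain ⟨e⟩ := nonempty_quotSMulTop_quotient_linearEquiv' hφ hφπ hker 𝔭.asIdeal
    rw [lengthAt_eq_of_linearEquiv e]
    by_cases hht : 𝔭.asIdeal.height = 1
    · rw [charIdeal_quotient_prime_of_height_eq_one 𝔭 hht]
    · rw [charIdeal_quotient_prime_of_height_ne_one 𝔭 h0 hht, Ideal.one_eq_top, Ideal.map_top,
        PowerSeriesSpecialization.lengthAt_quotient_top]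
      refine lengthAt_quotient_eq_zero_of_not_le fun hle => ?_
      set Q := 𝔮.asIdeal.comap φ with hQ
      have h𝔭Q : 𝔭.asIdeal ≤ Q := Ideal.map_le_iff_le_comap.mp hle
      have hπQ : π ∈ Q := by
        rw [hQ, Ideal.mem_comap, hφπ]; exact 𝔮.asIdeal.zero_mem
      have hlt : 𝔭.asIdeal < Q := lt_of_le_of_ne h𝔭Q fun h => hπmem (h ▸ hπQ)
      have h1 := Ideal.height_strict_mono_of_isPrime_of_isPrime hlt
      have h2 : 𝔭.asIdeal.height < 2 := lt_of_lt_of_le h1 (height_comap_le hφ hφπ hker 𝔮 h𝔮)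
      obtain ⟨n, hn⟩ : ∃ n : ℕ, 𝔭.asIdeal.height = n :=
        ⟨_, (ENat.coe_toNat (Ideal.height_ne_top_of_isPrime)).symm⟩
      rw [hn] at h2 hht
      have hn0 : n ≠ 0 := fun h => h0 (Ideal.height_eq_zero_iff_eq_bot.mp (by rw [hn, h]; rfl))
      have hn1 : n ≠ 1 := fun h => hht (by rw [h]; rfl)
      have : n < 2 := by exact_mod_cast h2
      omega

end Cyclic

/-! ### The principal characteristic ideal and its image under `φ` -/

section CharGen

variable [IsDomain A] [IsDomain B] [IsNoetherianRing B] [UniqueFactorizationMonoid B]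

omit [Algebra A B] in
/-- For a module `N` over the factorial ring `B` killed by some `s` with `φ s ≠ 0` (and `π ≠ 0`), the characteristic
ideal is principal with a generator `F` satisfying `φ F ≠ 0` (otherwise `char(N) ⊆ (π)` and `N_{(π)} ≠ 0`).
[folklore] -/
theorem exists_charIdeal_eq_span_of_retraction (hφπ : φ π = 0) (hker : ∀ b : B, φ b = 0 → π ∣ b)
    (hπ0 : π ≠ 0) {s : B} (hs0 : φ s ≠ 0) (hs : ∀ m : N, s • m = 0) :
    ∃ F : B, charIdeal B N = Ideal.span {F} ∧ φ F ≠ 0 := by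
  obtain ⟨F, hF⟩ := (isPrincipal_charIdeal_of_ufm (R := B) (M := N)).principal
  refine ⟨F, hF, fun hc => ?_⟩
  let PX : PrimeSpectrum B := ⟨Ideal.span {π}, isPrime_span hφπ hker⟩
  have hle : charIdeal B N ≤ PX.asIdeal := by
    rw [hF]
    exact (Ideal.span_singleton_le_iff_mem _).mpr ((mem_span_iff_map_eq_zero hφπ hker).mpr hc)
  refine lengthAt_ne_zero_of_charIdeal_le (𝔮 := PX) (height_span_eq_one hφπ hker hπ0) hle ?_
  exact lengthAt_eq_zero_of_isTorsionBy (s := s) (fun m => hs m) PX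
    (fun h => hs0 ((mem_span_iff_map_eq_zero hφπ hker).mp h))

omit [Algebra A B] in
/-- **Additivity of `ℓ_𝔮(A / φ(char ·))`** along a short exact sequence `0 → N₁ → N₂ → N₃ → 0` with `N₂` finitely
generated and killed by some `s` with `φ s ≠ 0`: the characteristic ideal is multiplicative (Bourbaki AC VII §4.5
Prop. 10, tree `charIdeal_eq_mul_of_exact`), the generators have `φ ≠ 0`, and `ℓ_𝔮(A/(ab)) = ℓ_𝔮(A/(a)) + ℓ_𝔮(A/(b))`.
[folklore] -/
theorem lengthAt_quotient_map_charIdeal_eq_add_of_retraction (hφπ : φ π = 0)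
    (hker : ∀ b : B, φ b = 0 → π ∣ b) (hπ0 : π ≠ 0) {N₁ N₂ N₃ : Type*}
    [AddCommGroup N₁] [Module B N₁] [AddCommGroup N₂] [Module B N₂]
    [AddCommGroup N₃] [Module B N₃] [Module.Finite B N₂]
    (f : N₁ →ₗ[B] N₂) (g : N₂ →ₗ[B] N₃) (hf : Injective f)
    (hg : Surjective g) (hfg : Exact f g) {s : B}
    (hs0 : φ s ≠ 0) (hs : ∀ m : N₂, s • m = 0) (𝔮 : PrimeSpectrum A) :
    lengthAt A (A ⧸ (charIdeal B N₂).map φ) 𝔮 =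
      lengthAt A (A ⧸ (charIdeal B N₁).map φ) 𝔮 + lengthAt A (A ⧸ (charIdeal B N₃).map φ) 𝔮 := by
  have hs₁ : ∀ m : N₁, s • m = 0 := fun m => hf (by rw [map_smul, hs, map_zero])
  have hs₃ : ∀ m : N₃, s • m = 0 := fun m => by
    obtain ⟨n, rfl⟩ := hg m; rw [← map_smul, hs, map_zero]
  have hsne : s ≠ 0 := fun h => hs0 (by rw [h, map_zero])
  have hN₂ : Module.IsTorsion B N₂ := fun m =>
    ⟨⟨s, mem_nonZeroDivisors_of_ne_zero hsne⟩, hs m⟩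
  obtain ⟨F₁, hF₁, hF₁0⟩ := exists_charIdeal_eq_span_of_retraction (N := N₁) hφπ hker hπ0 hs0 hs₁
  obtain ⟨F₃, hF₃, hF₃0⟩ := exists_charIdeal_eq_span_of_retraction (N := N₃) hφπ hker hπ0 hs0 hs₃
  have hmul := charIdeal_eq_mul_of_exact hN₂ f g hf hg hfg
  have e₂ : (charIdeal B N₂).map φ = Ideal.span {φ F₁ * φ F₃} := by
    rw [hmul, Ideal.map_mul, hF₁, hF₃, Ideal.map_span, Set.image_singleton, Ideal.map_span,
      Set.image_singleton, Ideal.span_singleton_mul_span_singleton]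
  have e₁ : (charIdeal B N₁).map φ = Ideal.span {φ F₁} := by
    rw [hF₁, Ideal.map_span, Set.image_singleton]
  have e₃ : (charIdeal B N₃).map φ = Ideal.span {φ F₃} := by
    rw [hF₃, Ideal.map_span, Set.image_singleton]
  rw [PowerSeriesSpecialization.lengthAt_quotient_congr e₂,
    PowerSeriesSpecialization.lengthAt_quotient_congr e₁,
    PowerSeriesSpecialization.lengthAt_quotient_congr e₃, lengthAt_quotient_span_singleton_mul _ hF₁0]

end CharGen

end Summit.BirchSwinnertonDyer.BirchSwinnertonDyer.Theorems.RetractionSpecialization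

end
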